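import Summits.Ventures.PackingBounds.Configurations.GramIsometry
import HarnessLib

/-!
# Any two triangular bipyramids on `S²` are isometric

Framing: lottery ticket; floor = certified bounds/negative ranges. Venture `PackingBounds`, cell
`pub-packcert`, energy family E3PT (pub-packcert-energy gen 11).

The structural description produced by the rigidity theorems (`Bipyramid5.rigid`,
`FivePointThomson.thomson_five_points_rigid`) — an antipodal pair `±p ∈ C` with the other three points
orthogonal to `p` and pairwise at inner product `-1/2` — determines the Gram matrix of the five points,
hence the configuration up to a linear isometry of `ℝ³` (`Config.exists_linearIsometryEquiv_of_inner_eq`).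
-/

noncomputable section

open Finset
open scoped RealInnerProductSpace

namespace Summit.Ventures.PackingBounds.Energy.Bipyramid5

open Summit.Ventures.PackingBounds.Config

/-- An enumeration `![p, -p, a, b, c]` of a triangular bipyramid, exhausting `C`, with its Gram matrix. -/
theorem exists_enum (C : Finset (EuclideanSpace ℝ (Fin 3))) (hC : ∀ x ∈ C, ‖x‖ = 1) (h5 : C.card = 5)
    (hT : ∃ p ∈ C, -p ∈ C ∧ (∀ z ∈ C, z ≠ p → z ≠ -p → inner ℝ z p = 0)
      ∧ (∀ z ∈ C, ∀ w ∈ C, z ≠ p → z ≠ -p → w ≠ p → w ≠ -p → z ≠ w → inner ℝ z w = -1 / 2)) :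
    ∃ v : Fin 5 → EuclideanSpace ℝ (Fin 3), (∀ i, v i ∈ C) ∧ (∀ x ∈ C, ∃ i, v i = x) ∧
      (∀ i j, inner ℝ (v i) (v j) =
        (![![1, -1, 0, 0, 0], ![-1, 1, 0, 0, 0], ![0, 0, 1, -1/2, -1/2], ![0, 0, -1/2, 1, -1/2],
           ![0, 0, -1/2, -1/2, 1]] : Fin 5 → Fin 5 → ℝ) i j) := by
  classical
  obtain ⟨p, hp, hnp, horth, hequi⟩ := hT
  have hp0 : p ≠ 0 := by
    intro h; have := hC p hp; rw [h, norm_zero] at this; norm_num at this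
  have hpnp : p ≠ -p := fun h => hp0 (by
    have : (2 : ℝ) • p = 0 := by rw [two_smul]; nth_rewrite 2 [h]; exact add_neg_cancel p
    exact (smul_eq_zero.1 this).resolve_left two_ne_zero)
  have hnpC : -p ∈ C.erase p := Finset.mem_erase.2 ⟨fun h => hpnp h.symm, hnp⟩
  have hRcard : ((C.erase p).erase (-p)).card = 3 := by
    rw [Finset.card_erase_of_mem hnpC, Finset.card_erase_of_mem hp, h5]
  obtain ⟨a, b, c, hab, hac, hbc, hR⟩ := Finset.card_eq_three.1 hRcard
  have hmem : ∀ z, z ∈ (C.erase p).erase (-p) ↔ z ∈ C ∧ z ≠ p ∧ z ≠ -p := by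
    intro z; rw [Finset.mem_erase, Finset.mem_erase]; tauto
  have haR : a ∈ (C.erase p).erase (-p) := by rw [hR]; simp
  have hbR : b ∈ (C.erase p).erase (-p) := by rw [hR]; simp
  have hcR : c ∈ (C.erase p).erase (-p) := by rw [hR]; simp
  obtain ⟨haC, hap, hanp⟩ := (hmem a).1 haR
  obtain ⟨hbC, hbp, hbnp⟩ := (hmem b).1 hbR
  obtain ⟨hcC, hcp, hcnp⟩ := (hmem c).1 hcR
  have spp : inner ℝ p p = (1 : ℝ) := by rw [real_inner_self_eq_norm_sq, hC p hp]; norm_num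
  have saa : inner ℝ a a = (1 : ℝ) := by rw [real_inner_self_eq_norm_sq, hC a haC]; norm_num
  have sbb : inner ℝ b b = (1 : ℝ) := by rw [real_inner_self_eq_norm_sq, hC b hbC]; norm_num
  have scc : inner ℝ c c = (1 : ℝ) := by rw [real_inner_self_eq_norm_sq, hC c hcC]; norm_num
  have sap : inner ℝ a p = 0 := horth a haC hap hanp
  have sbp : inner ℝ b p = 0 := horth b hbC hbp hbnp
  have scp : inner ℝ c p = 0 := horth c hcC hcp hcnp
  have spa : inner ℝ p a = 0 := by rw [real_inner_comm]; exact sap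
  have spb : inner ℝ p b = 0 := by rw [real_inner_comm]; exact sbp
  have spc : inner ℝ p c = 0 := by rw [real_inner_comm]; exact scp
  have sab : inner ℝ a b = -1 / 2 := hequi a haC b hbC hap hanp hbp hbnp hab
  have sac : inner ℝ a c = -1 / 2 := hequi a haC c hcC hap hanp hcp hcnp hac
  have sbc : inner ℝ b c = -1 / 2 := hequi b hbC c hcC hbp hbnp hcp hcnp hbc
  have sba : inner ℝ b a = -1 / 2 := by rw [real_inner_comm]; exact sab
  have sca : inner ℝ c a = -1 / 2 := by rw [real_inner_comm]; exact sac
  have scb : inner ℝ c b = -1 / 2 := by rw [real_inner_comm]; exact sbc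
  refine ⟨![p, -p, a, b, c], ?_, ?_, ?_⟩
  · simp only [Fin.forall_fin_succ, IsEmpty.forall_iff, and_true, Matrix.cons_val_zero,
      Matrix.cons_val_succ]
    exact ⟨hp, hnp, haC, hbC, hcC⟩
  · intro x hx
    by_cases h1 : x = p
    · exact ⟨0, by simp [h1]⟩
    by_cases h2 : x = -p
    · exact ⟨1, by simp [h2]⟩
    have hxR : x ∈ (C.erase p).erase (-p) := (hmem x).2 ⟨hx, h1, h2⟩
    rw [hR, Finset.mem_insert, Finset.mem_insert, Finset.mem_singleton] at hxR
    rcases hxR with h | h | h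
    · exact ⟨2, by simp [h]⟩
    · exact ⟨3, by simp [h]⟩
    · exact ⟨4, by simp [h]⟩
  · simp only [Fin.forall_fin_succ, IsEmpty.forall_iff, and_true, Matrix.cons_val_zero,
      Matrix.cons_val_succ, inner_neg_left, inner_neg_right, spp, saa, sbb, scc, sap, sbp, scp,
      spa, spb, spc, sab, sac, sbc, sba, sca, scb]
    norm_num

/-- **Any two triangular bipyramids on `S²` are isometric** (a linear isometry of `ℝ³` maps one onto
the other). -/
theorem isometric (C C' : Finset (EuclideanSpace ℝ (Fin 3))) (hC : ∀ x ∈ C, ‖x‖ = 1) (h5 : C.card = 5)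
    (hT : ∃ p ∈ C, -p ∈ C ∧ (∀ z ∈ C, z ≠ p → z ≠ -p → inner ℝ z p = 0)
      ∧ (∀ z ∈ C, ∀ w ∈ C, z ≠ p → z ≠ -p → w ≠ p → w ≠ -p → z ≠ w → inner ℝ z w = -1 / 2))
    (hC' : ∀ x ∈ C', ‖x‖ = 1) (h5' : C'.card = 5)
    (hT' : ∃ p ∈ C', -p ∈ C' ∧ (∀ z ∈ C', z ≠ p → z ≠ -p → inner ℝ z p = 0)
      ∧ (∀ z ∈ C', ∀ w ∈ C', z ≠ p → z ≠ -p → w ≠ p → w ≠ -p → z ≠ w → inner ℝ z w = -1 / 2)) :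
    ∃ Ψ : EuclideanSpace ℝ (Fin 3) ≃ₗᵢ[ℝ] EuclideanSpace ℝ (Fin 3), C' = C.image Ψ := by
  classical
  obtain ⟨v, hvC, hvsurj, hvG⟩ := exists_enum C hC h5 hT
  obtain ⟨w, hwC, hwsurj, hwG⟩ := exists_enum C' hC' h5' hT'
  have hgram : ∀ i j, inner ℝ (v i) (v j) = inner ℝ (w i) (w j) := fun i j => by rw [hvG, hwG]
  obtain ⟨Ψ, hΨ⟩ := exists_linearIsometryEquiv_of_inner_eq v w hgram
  have hCv : C = Finset.univ.image v := by
    ext x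
    simp only [Finset.mem_image, Finset.mem_univ, true_and]
    exact ⟨fun hx => hvsurj x hx, fun ⟨i, hi⟩ => hi ▸ hvC i⟩
  have hCw : C' = Finset.univ.image w := by
    ext x
    simp only [Finset.mem_image, Finset.mem_univ, true_and]
    exact ⟨fun hx => hwsurj x hx, fun ⟨i, hi⟩ => hi ▸ hwC i⟩
  refine ⟨Ψ, ?_⟩
  rw [hCv, hCw, Finset.image_image]
  congr 1
  funext i
  exact (hΨ i).symm

end Summit.Ventures.PackingBounds.Energy.Bipyramid5
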